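import Summits.ResolutionOfSingularities.ResolutionOfSingularities.Theorems.EquisingularLiftEquisingularLiftNatProjectiveSpaceLineSplitting
import HarnessLib

/-!
# [OURS · L1 W4.5(b) · EL♮(3) · nose residue, brick N-1 (b), part 2/2] The line `Σ = V(x₂, x₃) ⊂ ℙ³_K` has unobstructed embedded deformations:
# `DirStepUnobs ℙ³ univ _ Σ` — the first TWISTED instance of the `DirStepUnobs` producer (`𝒩_{Σ/ℙ³} = 𝒪(1)²`)

Cell `res-hironaka`, LADDER-RESOLUTION rung L (D-0089), slot W4.5(b), crux chain w45b: child crux **EL♮(3)** =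
stmt-ResolutionOfSingularities-20148, parent EL♮ = stmt-…-20038; registered nose residue
`stub_elnat_three_nonisolated_nonUnobsNonPointsFirstNoseBTriplePrime` (38th registration), hypothesis `¬ NoseHypUnobsBTriplePrime` ((H-ν1), 37th).
WIDTH seat res-L1-w45b-nose-w1 g2 (D-0157 DOOR 1), desk booking **N-1** «Whitney cubic ∈ ν1» (STATUS 2026-08-28T18:04:04Z), piece (b) of three
((a) ✓ `…NatNoseHypUnobsOfOneBlowup`, (c) the assembly `…NatSpecimenWhitneyCubicNu1`). `--supports stmt-ResolutionOfSingularities-20148 --as helper`.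
OURS; NOT a statement of H. Hironaka's 2017 manuscript (nothing of [Hironaka2017] is asserted); AI-written, AI review weaker than expert review.
DEFINITION-FREE (local `notation3` abbreviations only); no `sorry`; standard axioms. EL♮(3) is NOT proved here; resolution in positive characteristic
is NOT proved here (dimension 3 is Cossart–Piltant 2008/2009 in print).

THIS PART (2/2): sections over `D₊(x₀x₁)`, the charts, quasi-regularity, the ideal, and the assembly; part 1/2 (`…NatProjectiveSpaceLineSplitting`)
holds the ring-level splitting ★ `exists_split`. WHAT. `P3Line.dirStepUnobs_doubleLine (K) [Field K] : DirStepUnobs ℙ³_K Set.univ isClosed_univ Σ _` for the coordinate line `Σ = V₊(x₂, x₃)` (the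
double line of res-D-pv-022's Whitney-type cubic and of every cubic of res-L1-w45b-nose-w3's census), i.e. `Ȟ¹(Σ̃, 𝒩_{Σ̃/ℙ³}) = 0` in the tree's Čech
currency — obtained from ✓ p655133 `dirStepUnobs_univ_of_two_charts` (res-L1-w45b-nose-w1, D3-7) with the data:
charts `D₊(x₀)`, `D₊(x₁)` (`ProjSubscheme.affineBasicOpen`; `D₊(x₀) ∩ D₊(x₁) = D₊(x₀x₁)` affine; they cover `Σ` because a relevant prime containing
`x₂, x₃` cannot contain `x₀` and `x₁`, `ProjectiveSpace.irrelevant_le_span`); generators `(x₂/xᵢ, x₃/xᵢ)` read through Mathlib's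
`Proj.awayToSection : (K[x]_{xᵢ})₀ ≅ Γ(ℙ³, D₊(xᵢ))`, QUASI-REGULAR by transport (`IsQuasiRegular.map_ringEquiv`) of the regular sequence `(y₁, y₂)` of
`K[y₀, y₁, y₂]` (`isWeaklyRegular_map_X`, `isQuasiRegular_of_isWeaklyRegular`) along `ProjectiveSpace.chartAlgEquiv`; THE IDEAL `𝓘⟨Σ⟩.ideal D₊(xᵢ) =
(x₂/xᵢ, x₃/xᵢ)`: `𝓘⟨Σ⟩ = ker Proj(f_K)` for the kill map `f_K : K[x₀..x₃] → K[x₀, x₁]` (nose-w3 ✓ `ker_projMap_kill_eq_vanishingIdeal_doubleLine`), whose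
sections over `D₊(s)` are `(ker f_K)_{(s)}` (Literature ✓ `ker_projMap_ideal_basicOpen`, `awayIdeal_span_eq`; `ker f_K = (x₂, x₃)` by `LinearCentre.ker_kill`);
TRANSITION MATRIX `M = (x₁/x₀)·1` (`x_{k}/x₀ = (x₁/x₀)(x_{k}/x₁)`, `res₀_chartGen_succ`); and ★ THE TWISTED SPLITTING `exists_split`: every degree-zero fraction
`z ∈ (K[x]_{x₀x₁})₀` is `a| + (x₁/x₀)·b|` MODULO `(ker f_K)_{(x₀x₁)}` with `a ∈ (K[x]_{x₀})₀`, `b ∈ (K[x]_{x₁})₀` — monomial by monomial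
(`awayMk_eq_sum_monomial`): a monomial involving `x₂` or `x₃` is in the ideal (`kill_monomial_eq_zero`), and `x₀ⁱx₁ʲ/(x₀x₁)ᵐ` (`i + j = 2m`) is
`(x₁/x₀)^{j−m}` from `D₊(x₀)` if `j ≥ m` (`monFrac_eq_res₀`) and `(x₁/x₀)·(x₀/x₁)^{i−m+1}` from `D₊(x₁)` if `j < m` (`monFrac_eq_tEl_mul_res₁`) — this is
`H¹(ℙ¹, 𝒪(1)) = 0` computed by hand; `hsplit_basicOpen` moves it to sections over `D₊(x₀x₁)` (`Proj.awayMap_awayToSection`, `Proj.basicOpenIsoAway`) and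
`transport_of_eq` to the syntactic overlap `D₊(x₀) ⊓ D₊(x₁)` (`Proj.basicOpen_mul`).

References (method / index only): R. Hartshorne, *Algebraic Geometry* (1977), II Prop. 2.5, II Prop. 5.11 (proof), III Thm. 5.1 (Čech cohomology of
`𝒪(n)` on the standard cover) [cite: Hartshorne1977]; The Stacks Project, Tag 01ED [cite: StacksProject].
-/

set_option linter.dupNamespace false -- mandated namespace `Summit.<Summit>.<Problem>` of this single-conjunct summit

noncomputable section

-- `TopCat.Presheaf`/`Scheme.Modules` are not reducible (as in Mathlib's `AlgebraicGeometry/Modules`).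
set_option backward.isDefEq.respectTransparency false

open CategoryTheory CategoryTheory.Limits AlgebraicGeometry TopologicalSpace Opposite
open MvPolynomial HomogeneousLocalization
open Literature.AlgebraicGeometry.Resolution
open Literature.AlgebraicGeometry.Motives

namespace Summit.ResolutionOfSingularities.ResolutionOfSingularities.Cruxes.EquisingularLiftNat.Sections

namespace P3Line

variable (K : Type) [Field K]

attribute [local instance] MvPolynomial.gradedAlgebra ProjBaseChange.algebraBase

local notation "𝒜" => MvPolynomial.homogeneousSubmodule (Fin (1 + 2 + 1)) K
local notation "A4" => MvPolynomial (Fin (1 + 2 + 1)) K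

/-! Local abbreviations (notation only; the file stays definition-free): the restrictions `res₀ : (K[x]_{x₀})₀ → (K[x]_{x₀x₁})₀`,
`res₁ : (K[x]_{x₁})₀ → (K[x]_{x₀x₁})₀` (Mathlib `HomogeneousLocalization.awayMap`), the transition function `tEl = x₁/x₀ = x₁²/(x₀x₁)`,
Mathlib's section isomorphism `aTS[s] : (K[x]_s)₀ → Γ(ℙ³, D₊(s))` (`Proj.awayToSection`), the affine charts `U[i] = D₊(xᵢ)`, the chart sections
`gens[i] = (x_{i⁺1}/xᵢ, x_{i⁺2}/xᵢ)` (`i⁺ = i.succAbove`; for `i = 0, 1` these are `(x₂/xᵢ, x₃/xᵢ)`), and `kerKill[f]` the kernel of a graded map. -/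
local notation3 "res₀" => HomogeneousLocalization.awayMap (MvPolynomial.homogeneousSubmodule (Fin (1 + 2 + 1)) K) (ProjectiveSpace.X_mem (R := K) (1 : Fin (1 + 2 + 1)))
  (rfl : (X 0 * X 1 : MvPolynomial (Fin (1 + 2 + 1)) K) = X 0 * X 1)
local notation3 "res₁" => HomogeneousLocalization.awayMap (MvPolynomial.homogeneousSubmodule (Fin (1 + 2 + 1)) K) (ProjectiveSpace.X_mem (R := K) (0 : Fin (1 + 2 + 1)))
  (mul_comm (X 0 : MvPolynomial (Fin (1 + 2 + 1)) K) (X 1))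
local notation3 "tEl" => HomogeneousLocalization.Away.mk (MvPolynomial.homogeneousSubmodule (Fin (1 + 2 + 1)) K) (X01_mem K) 1 (X 1 ^ 2 : MvPolynomial (Fin (1 + 2 + 1)) K) (X_one_sq_mem K)
local notation3 "aTS[" s "]" => CommRingCat.Hom.hom (Proj.awayToSection (MvPolynomial.homogeneousSubmodule (Fin (1 + 2 + 1)) K) s)
local notation3 "U[" i "]" => ProjSubscheme.affineBasicOpen (MvPolynomial.homogeneousSubmodule (Fin (1 + 2 + 1)) K) (X i : MvPolynomial (Fin (1 + 2 + 1)) K)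
  (ProjectiveSpace.X_mem (R := K) i) one_pos
local notation3 "gens[" i "]" => fun k : Fin 2 =>
  CommRingCat.Hom.hom (Proj.awayToSection (MvPolynomial.homogeneousSubmodule (Fin (1 + 2 + 1)) K) (X i : MvPolynomial (Fin (1 + 2 + 1)) K)) (ProjectiveSpace.chartGen K i k.succ)
local notation3 "kerKill[" f "]" => RingHom.ker (R := MvPolynomial (Fin (1 + 2 + 1)) K) (S := MvPolynomial (Fin (1 + 1)) K) f

/-! ## §2 The same on SECTIONS of `ℙ³` over `D₊(x₀x₁)` -/

/-- `D₊(x₀x₁) ⊆ D₊(x₀)`. [folklore] -/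
theorem le₀ : Proj.basicOpen 𝒜 (X 0 * X 1 : A4) ≤ Proj.basicOpen 𝒜 (X 0) :=
  (Proj.basicOpen_mul 𝒜 (X 0 : A4) (X 1)).trans_le inf_le_left

/-- `D₊(x₀x₁) ⊆ D₊(x₁)`. [folklore] -/
theorem le₁ : Proj.basicOpen 𝒜 (X 0 * X 1 : A4) ≤ Proj.basicOpen 𝒜 (X 1) :=
  (Proj.basicOpen_mul 𝒜 (X 0 : A4) (X 1)).trans_le inf_le_right

/-- Restriction from `D₊(x₀)` to `D₊(x₀x₁)` is `res₀` on fractions. -/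
theorem map_aTS₀ (h : Proj.basicOpen 𝒜 (X 0 * X 1 : A4) ≤ Proj.basicOpen 𝒜 (X 0)) (a : Away 𝒜 (X 0 : A4)) :
    (Proj 𝒜).presheaf.map (homOfLE h).op (aTS[(X 0 : A4)] a) = aTS[(X 0 * X 1 : A4)] (res₀ a) := by
  have e := ConcreteCategory.congr_hom
    (Proj.awayMap_awayToSection 𝒜 (f := (X 0 : A4)) (ProjectiveSpace.X_mem (R := K) 1) (x := X 0 * X 1) rfl) a
  exact e.symm

/-- Restriction from `D₊(x₁)` to `D₊(x₀x₁)` is `res₁` on fractions. -/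
theorem map_aTS₁ (h : Proj.basicOpen 𝒜 (X 0 * X 1 : A4) ≤ Proj.basicOpen 𝒜 (X 1)) (b : Away 𝒜 (X 1 : A4)) :
    (Proj 𝒜).presheaf.map (homOfLE h).op (aTS[(X 1 : A4)] b) = aTS[(X 0 * X 1 : A4)] (res₁ b) := by
  have e := ConcreteCategory.congr_hom
    (Proj.awayMap_awayToSection 𝒜 (f := (X 1 : A4)) (ProjectiveSpace.X_mem (R := K) 0) (x := X 0 * X 1) (mul_comm _ _)) b
  exact e.symm

/-- `res₀ (x₁/x₀) = t`. -/
theorem res₀_chartGen_zero : res₀ (ProjectiveSpace.chartGen K 0 0) = tEl := by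
  rw [ProjectiveSpace.chartGen, awayMap_mk]
  apply HomogeneousLocalization.val_injective
  simp only [HomogeneousLocalization.Away.val_mk]
  exact Localization.mk_eq_mk_iff.mpr (Localization.r_of_eq (by simp; ring))

/-- The transition of generators: `x_{k+2}/x₀ = (x₁/x₀)·(x_{k+2}/x₁)` on the overlap (`k = 0, 1`). -/
theorem res₀_chartGen_succ (k : Fin 2) :
    res₀ (ProjectiveSpace.chartGen K 0 k.succ) = tEl * res₁ (ProjectiveSpace.chartGen K 1 k.succ) := by
  rw [ProjectiveSpace.chartGen, ProjectiveSpace.chartGen, awayMap_mk, awayMap_mk,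
    Literature.AlgebraicGeometry.Resolution.Away.mk_mul_mk]
  apply HomogeneousLocalization.val_injective
  simp only [HomogeneousLocalization.Away.val_mk]
  refine Localization.mk_eq_mk_iff.mpr (Localization.r_of_eq ?_)
  have h11 : (1 : Fin (1 + 2 + 1)).succAbove 1 = 2 := by decide
  have h12 : (1 : Fin (1 + 2 + 1)).succAbove 2 = 3 := by decide
  fin_cases k <;> simp [h11, h12] <;> ring

section KillSections

variable (fk : MvPolynomial.homogeneousSubmodule (Fin (1 + 2 + 1)) K →+*ᵍ MvPolynomial.homogeneousSubmodule (Fin (1 + 1)) K)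
  (hfk' : HomogeneousIdeal.irrelevant (MvPolynomial.homogeneousSubmodule (Fin (1 + 1)) K) ≤
    (HomogeneousIdeal.irrelevant (MvPolynomial.homogeneousSubmodule (Fin (1 + 2 + 1)) K)).map fk)
  (hfkC : ∀ a : K, fk (C a) = C a)
  (hfkX : ∀ i : Fin (1 + 2 + 1), fk (X i) = if h : (i : ℕ) < 1 + 1 then X ⟨i, h⟩ else 0)

include hfkC hfkX in
/-- ★ **Twisted splitting of sections over `D₊(x₀x₁)` modulo the ideal sheaf of the line** (sections form of `exists_split`). -/
theorem hsplit_basicOpen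
    (h0 : Proj.basicOpen 𝒜 (X 0 * X 1 : A4) ≤ Proj.basicOpen 𝒜 (X 0)) (h1 : Proj.basicOpen 𝒜 (X 0 * X 1 : A4) ≤ Proj.basicOpen 𝒜 (X 1))
    (c : Fin 2 → Γ(Proj 𝒜, Proj.basicOpen 𝒜 (X 0 * X 1 : A4))) :
    ∃ (a : Fin 2 → Γ(Proj 𝒜, Proj.basicOpen 𝒜 (X 0 : A4))) (b : Fin 2 → Γ(Proj 𝒜, Proj.basicOpen 𝒜 (X 1 : A4))), ∀ k,
      c k - ((Proj 𝒜).presheaf.map (homOfLE h0).op (a k) +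
        ∑ j, (if k = j then (Proj 𝒜).presheaf.map (homOfLE h0).op (aTS[(X 0 : A4)] (ProjectiveSpace.chartGen K 0 0)) else 0) *
          (Proj 𝒜).presheaf.map (homOfLE h1).op (b j)) ∈
        (Proj.map fk hfk').ker.ideal ⟨Proj.basicOpen 𝒜 (X 0 * X 1 : A4), Proj.isAffineOpen_basicOpen 𝒜 _ (X01_mem K) two_pos⟩ := by
  classical
  have hsurj : Function.Surjective fk :=
    EquisingularLift.StrataSplit.LinearCentre.kill_surjective (r := 1) (m := 2) fk.toRingHom (fun a => hfkC a) (fun i => hfkX i)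
  have hbij : Function.Bijective (aTS[(X 0 * X 1 : A4)]) :=
    ConcreteCategory.bijective_of_isIso (Proj.basicOpenIsoAway 𝒜 (X 0 * X 1 : A4) (X01_mem K) two_pos).hom
  choose z hz using fun k => hbij.2 (c k)
  choose a b hab using fun k => exists_split K fk hfkX (z k)
  refine ⟨fun k => aTS[(X 0 : A4)] (a k), fun k => aTS[(X 1 : A4)] (b k), fun k => ?_⟩
  have hJ : (Proj.map fk hfk').ker.ideal ⟨Proj.basicOpen 𝒜 (X 0 * X 1 : A4), Proj.isAffineOpen_basicOpen 𝒜 _ (X01_mem K) two_pos⟩ =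
      (awayIdeal 𝒜 (X01_mem K) (kerKill[fk])).map (aTS[(X 0 * X 1 : A4)]) :=
    ker_projMap_ideal_basicOpen fk hfk' hsurj two_pos (X01_mem K)
  rw [hJ]
  simp only [ite_mul, zero_mul, Finset.sum_ite_eq, Finset.mem_univ, if_true]
  have e1 : (Proj 𝒜).presheaf.map (homOfLE h0).op (aTS[(X 0 : A4)] (a k)) = aTS[(X 0 * X 1 : A4)] (res₀ (a k)) := map_aTS₀ K h0 (a k)
  have e2 : (Proj 𝒜).presheaf.map (homOfLE h1).op (aTS[(X 1 : A4)] (b k)) = aTS[(X 0 * X 1 : A4)] (res₁ (b k)) := map_aTS₁ K h1 (b k)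
  have e3 : (Proj 𝒜).presheaf.map (homOfLE h0).op (aTS[(X 0 : A4)] (ProjectiveSpace.chartGen K 0 0)) = aTS[(X 0 * X 1 : A4)] (tEl) := by
    rw [map_aTS₀, res₀_chartGen_zero]
  rw [← hz k, e1, e2, e3]
  have hmem := Ideal.mem_map_of_mem (aTS[(X 0 * X 1 : A4)]) (hab k)
  rw [map_sub, map_add, map_mul] at hmem
  exact hmem

end KillSections

/-! ## §3 The two standard charts of `ℙ³` around the line: generators, quasi-regularity, cover -/

/-- `D₊(x₀) ∩ D₊(x₁) = D₊(x₀x₁)` is affine. -/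
theorem isAffineOpen_inf : IsAffineOpen (((U[0]) : (Proj 𝒜).Opens) ⊓ U[1]) := by
  rw [ProjSubscheme.affineBasicOpen_coe, ProjSubscheme.affineBasicOpen_coe, ← Proj.basicOpen_mul]
  exact Proj.isAffineOpen_basicOpen 𝒜 _ (X01_mem K) two_pos

/-- `(y₁, y₂)` is a quasi-regular sequence in `K[y₀, y₁, y₂]`. -/
theorem isQuasiRegular_X_one_X_two : IsQuasiRegular (![X 1, X 2] : Fin 2 → MvPolynomial (Fin (1 + 2)) K) := by
  refine isQuasiRegular_of_isWeaklyRegular _ ?_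
  have hl : List.ofFn (![X 1, X 2] : Fin 2 → MvPolynomial (Fin (1 + 2)) K) = ([1, 2] : List (Fin (1 + 2))).map X := by
    simp [List.ofFn_succ]
  rw [hl]
  exact Literature.AlgebraicGeometry.Resolution.MvPolynomial.isWeaklyRegular_map_X (R := K) [1, 2] (by decide)

/-- The chart generators `(x₂/xᵢ, x₃/xᵢ)` are quasi-regular in `Γ(ℙ³, D₊(xᵢ))` (`i = 0, 1`): transport of `(y₁, y₂)` along
`K[y] ≅ (K[x]_{xᵢ})₀ ≅ Γ(D₊(xᵢ))`. -/
theorem isQuasiRegular_gens (i : Fin (1 + 2 + 1)) : IsQuasiRegular (gens[i]) := by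
  let e : MvPolynomial (Fin (1 + 2)) K ≃+* Γ(Proj 𝒜, ((U[i]) : (Proj 𝒜).Opens)) :=
    (ProjectiveSpace.chartAlgEquiv K i).symm.toRingEquiv.trans
      (Proj.basicOpenIsoAway 𝒜 (X i : A4) (ProjectiveSpace.X_mem (R := K) i) one_pos).commRingCatIsoToRingEquiv
  have h := (isQuasiRegular_X_one_X_two K).map_ringEquiv e
  have hfun : (e ∘ (![X 1, X 2] : Fin 2 → MvPolynomial (Fin (1 + 2)) K)) = gens[i] := by
    funext k
    have hk : (![X 1, X 2] : Fin 2 → MvPolynomial (Fin (1 + 2)) K) k = X k.succ := by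
      fin_cases k <;> rfl
    simp only [Function.comp_apply, hk, e, RingEquiv.coe_trans, Function.comp_apply,
      AlgEquiv.coe_ringEquiv, ProjectiveSpace.chartAlgEquiv_symm_X]
    rfl
  rwa [hfun] at h

section Assembly

variable (fk : MvPolynomial.homogeneousSubmodule (Fin (1 + 2 + 1)) K →+*ᵍ MvPolynomial.homogeneousSubmodule (Fin (1 + 1)) K)
  (hfk' : HomogeneousIdeal.irrelevant (MvPolynomial.homogeneousSubmodule (Fin (1 + 1)) K) ≤
    (HomogeneousIdeal.irrelevant (MvPolynomial.homogeneousSubmodule (Fin (1 + 2 + 1)) K)).map fk)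
  (hfkC : ∀ a : K, fk (C a) = C a)
  (hfkX : ∀ i : Fin (1 + 2 + 1), fk (X i) = if h : (i : ℕ) < 1 + 1 then X ⟨i, h⟩ else 0)

include hfkC hfkX in
/-- `ker f_K = (x₂, x₃)` in generator form. -/
theorem ker_kill_eq_span : kerKill[fk] = Ideal.span (Set.range (fun k : Fin 2 => (X k.succ.succ : A4))) := by
  have h := EquisingularLift.StrataSplit.LinearCentre.ker_kill (r := 1) (m := 2) fk.toRingHom (fun a => hfkC a) (fun i => hfkX i)
  change RingHom.ker fk.toRingHom = _ at h
  rw [show RingHom.ker (R := A4) (S := MvPolynomial (Fin (1 + 1)) K) fk = RingHom.ker fk.toRingHom from rfl, h]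
  congr 1
  ext p
  simp only [Set.mem_image, Set.mem_setOf_eq, Set.mem_range]
  constructor
  · rintro ⟨i, hi, rfl⟩
    refine ⟨⟨(i : ℕ) - 2, by omega⟩, ?_⟩
    congr 1
    ext; simp; omega
  · rintro ⟨k, rfl⟩
    exact ⟨k.succ.succ, by simp, rfl⟩

include hfkC hfkX in
/-- The ideal of the line on the chart `D₊(xᵢ)` is generated by `(x₂/xᵢ, x₃/xᵢ)` (`i = 0, 1`). -/
theorem span_gens_eq (i : Fin (1 + 2 + 1)) (hi : ∀ k : Fin 2, i.succAbove k.succ = k.succ.succ) :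
    Ideal.span (Set.range (gens[i])) = (Proj.map fk hfk').ker.ideal (U[i]) := by
  have hsurj : Function.Surjective fk :=
    EquisingularLift.StrataSplit.LinearCentre.kill_surjective (r := 1) (m := 2) fk.toRingHom (fun a => hfkC a) (fun i => hfkX i)
  have hJ : (Proj.map fk hfk').ker.ideal (U[i]) = (awayIdeal 𝒜 (ProjectiveSpace.X_mem (R := K) i) (kerKill[fk])).map (aTS[(X i : A4)]) :=
    ker_projMap_ideal_basicOpen fk hfk' hsurj one_pos (ProjectiveSpace.X_mem (R := K) i)
  rw [hJ, ker_kill_eq_span K fk hfkC hfkX,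
    awayIdeal_span_eq 𝒜 (ProjectiveSpace.X_mem (R := K) i) _ (fun _ => 1) (fun k => by simpa using ProjectiveSpace.X_mem (R := K) _),
    Ideal.map_span, ← Set.range_comp]
  refine congrArg (fun f => Ideal.span (Set.range f)) (funext fun k => ?_)
  simp only [Function.comp_apply, ProjectiveSpace.chartGen, hi k]
  rfl

end Assembly

section Final

variable (fk : MvPolynomial.homogeneousSubmodule (Fin (1 + 2 + 1)) K →+*ᵍ MvPolynomial.homogeneousSubmodule (Fin (1 + 1)) K)
  (hfk' : HomogeneousIdeal.irrelevant (MvPolynomial.homogeneousSubmodule (Fin (1 + 1)) K) ≤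
    (HomogeneousIdeal.irrelevant (MvPolynomial.homogeneousSubmodule (Fin (1 + 2 + 1)) K)).map fk)
  (hfkC : ∀ a : K, fk (C a) = C a)
  (hfkX : ∀ i : Fin (1 + 2 + 1), fk (X i) = if h : (i : ℕ) < 1 + 1 then X ⟨i, h⟩ else 0)

/-- The transition of the chart generators on sections over `D₊(x₀x₁)`: `(x_{k+2}/x₀)| = (x₁/x₀)| · (x_{k+2}/x₁)|`. -/
theorem hM_basicOpen (h0 : Proj.basicOpen 𝒜 (X 0 * X 1 : A4) ≤ Proj.basicOpen 𝒜 (X 0))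
    (h1 : Proj.basicOpen 𝒜 (X 0 * X 1 : A4) ≤ Proj.basicOpen 𝒜 (X 1)) (k : Fin 2) :
    (Proj 𝒜).presheaf.map (homOfLE h0).op (gens[0] k) =
      ∑ j, (if k = j then (Proj 𝒜).presheaf.map (homOfLE h0).op (aTS[(X 0 : A4)] (ProjectiveSpace.chartGen K 0 0)) else 0) *
        (Proj 𝒜).presheaf.map (homOfLE h1).op (gens[1] j) := by
  classical
  simp only [ite_mul, zero_mul, Finset.sum_ite_eq, Finset.mem_univ, if_true]
  change (Proj 𝒜).presheaf.map (homOfLE h0).op (aTS[(X 0 : A4)] (ProjectiveSpace.chartGen K 0 k.succ)) =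
    (Proj 𝒜).presheaf.map (homOfLE h0).op (aTS[(X 0 : A4)] (ProjectiveSpace.chartGen K 0 0)) *
      (Proj 𝒜).presheaf.map (homOfLE h1).op (aTS[(X 1 : A4)] (ProjectiveSpace.chartGen K 1 k.succ))
  rw [map_aTS₀, map_aTS₀, map_aTS₁, res₀_chartGen_succ, res₀_chartGen_zero, map_mul]

include hfkC hfkX in
/-- Transport of `hM_basicOpen` / `hsplit_basicOpen` to any open EQUAL to `D₊(x₀x₁)` (used with `D₊(x₀) ⊓ D₊(x₁)`). -/
theorem transport_of_eq {V : (Proj 𝒜).Opens} (hV : V = Proj.basicOpen 𝒜 (X 0 * X 1 : A4)) (hVaff : IsAffineOpen V)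
    (h0 : V ≤ Proj.basicOpen 𝒜 (X 0)) (h1 : V ≤ Proj.basicOpen 𝒜 (X 1)) :
    (∀ k : Fin 2, (Proj 𝒜).presheaf.map (homOfLE h0).op (gens[0] k) =
      ∑ j, (if k = j then (Proj 𝒜).presheaf.map (homOfLE h0).op (aTS[(X 0 : A4)] (ProjectiveSpace.chartGen K 0 0)) else 0) *
        (Proj 𝒜).presheaf.map (homOfLE h1).op (gens[1] j)) ∧
    (∀ c : Fin 2 → Γ(Proj 𝒜, V), ∃ (a : Fin 2 → Γ(Proj 𝒜, Proj.basicOpen 𝒜 (X 0 : A4))) (b : Fin 2 → Γ(Proj 𝒜, Proj.basicOpen 𝒜 (X 1 : A4))),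
      ∀ k, c k - ((Proj 𝒜).presheaf.map (homOfLE h0).op (a k) +
        ∑ j, (if k = j then (Proj 𝒜).presheaf.map (homOfLE h0).op (aTS[(X 0 : A4)] (ProjectiveSpace.chartGen K 0 0)) else 0) *
          (Proj 𝒜).presheaf.map (homOfLE h1).op (b j)) ∈ (Proj.map fk hfk').ker.ideal ⟨V, hVaff⟩) := by
  subst hV
  exact ⟨hM_basicOpen K h0 h1, hsplit_basicOpen K fk hfk' hfkC hfkX h0 h1⟩

end Final

/-- The line `Σ = V(x₂, x₃)` is covered by the two charts `D₊(x₀)`, `D₊(x₁)`. -/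
theorem doubleLine_subset_union :
    {y : Proj 𝒜 | ∀ i, (![X 2, X 3] : Fin 2 → A4) i ∈ y.asHomogeneousIdeal} ⊆
      (((U[0]) : (Proj 𝒜).Opens) : Set (Proj 𝒜)) ∪ (((U[1]) : (Proj 𝒜).Opens) : Set (Proj 𝒜)) := by
  intro y hy
  by_contra h
  simp only [Set.mem_union, SetLike.mem_coe, not_or] at h
  have h0 : (X 0 : A4) ∈ y.asHomogeneousIdeal := by simpa [Proj.mem_basicOpen] using h.1
  have h1 : (X 1 : A4) ∈ y.asHomogeneousIdeal := by simpa [Proj.mem_basicOpen] using h.2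
  have h2 : (X 2 : A4) ∈ y.asHomogeneousIdeal := hy 0
  have h3 : (X 3 : A4) ∈ y.asHomogeneousIdeal := hy 1
  apply y.not_irrelevant_le
  intro p hp
  have hp' := ProjectiveSpace.irrelevant_le_span (1 + 2) K hp
  refine (Ideal.span_le.mpr ?_) hp'
  rintro _ ⟨i, rfl⟩
  fin_cases i
  · exact h0
  · exact h1
  · exact h2
  · exact h3

/-- ★★ **THE LINE `Σ = V(x₂, x₃) ⊂ ℙ³_K` HAS UNOBSTRUCTED EMBEDDED DEFORMATIONS**, kernel form: `DirStepUnobs ℙ³_K univ _ Σ` (`Ȟ¹(Σ̃, 𝒩_{Σ̃/ℙ³}) = 0`,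
`𝒩 ≅ 𝒪(1)²`) — the first TWISTED instance of the producer ✓ p655133 (`dirStepUnobs_univ_of_two_charts`): charts `D₊(x₀)`, `D₊(x₁)`, generators
`(x₂/xᵢ, x₃/xᵢ)`, transition `x₁/x₀`, splitting `exists_split`. [OURS · L1 W4.5b · EL♮(3) · N-1 (b); NOT a statement of the manuscript] -/
theorem dirStepUnobs_doubleLine :
    DirStepUnobs (Proj 𝒜) Set.univ isClosed_univ
      {y : Proj 𝒜 | ∀ i, (![X 2, X 3] : Fin 2 → A4) i ∈ y.asHomogeneousIdeal} (WhitneyCubic.isClosed_doubleLine K) := by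
  classical
  obtain ⟨fk, hfk', hfkC, hfkX⟩ := EquisingularLift.StrataSplit.LinearCentre.exists_kill K 1 2
  haveI : IsLocallyNoetherian (Proj 𝒜) := EquisingularLift.StrataSplit.LinearCentre.isLocallyNoetherian_proj K (1 + 2)
  haveI : IsReduced (Proj 𝒜) := Proj.isReduced 𝒜
  have hΛ := WhitneyCubic.ker_projMap_kill_eq_vanishingIdeal_doubleLine K fk hfk' hfkC hfkX (WhitneyCubic.isClosed_doubleLine K)
  obtain ⟨hM, hsplit⟩ := transport_of_eq K fk hfk' hfkC hfkX (V := ((U[0]) : (Proj 𝒜).Opens) ⊓ U[1])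
    (by rw [ProjSubscheme.affineBasicOpen_coe, ProjSubscheme.affineBasicOpen_coe, ← Proj.basicOpen_mul])
    (isAffineOpen_inf K) inf_le_left inf_le_right
  refine dirStepUnobs_univ_of_two_charts (Proj 𝒜) _ (WhitneyCubic.isClosed_doubleLine K) (U[0]) (U[1]) (isAffineOpen_inf K)
    (doubleLine_subset_union K) (gens[0]) (gens[1]) (isQuasiRegular_gens K 0) (isQuasiRegular_gens K 1) ?_ ?_
    (fun k j => if k = j then (Proj 𝒜).presheaf.map (homOfLE inf_le_left).op (aTS[(X 0 : A4)] (ProjectiveSpace.chartGen K 0 0)) else 0)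
    hM ?_
  · rw [← hΛ]; exact span_gens_eq K fk hfk' hfkC hfkX 0 (fun k => by fin_cases k <;> decide)
  · rw [← hΛ]; exact span_gens_eq K fk hfk' hfkC hfkX 1 (fun k => by fin_cases k <;> decide)
  · rw [← hΛ]; exact hsplit

end P3Line

end Summit.ResolutionOfSingularities.ResolutionOfSingularities.Cruxes.EquisingularLiftNat.Sections

end
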